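import Summits.BirchSwinnertonDyer.BirchSwinnertonDyer.Theorems.SmallImageMuTransferMuTransferX9LocalTwistOperator
import Literature.NumberTheory.EllipticCurves.IwasawaTwistModPShapiro
import HarnessLib

/-!
# K6 crux `MuTransferX9` (stmt-BirchSwinnertonDyer-19276), conditional surface F2 (aside 19844),
# input of steps (b1)/(d) of «Lemma 8.5 (2) on the pin»: the powers `σ^i`, `i < p^{m−n'}`, of an
# element `σ` of DEPTH EXACTLY `n'` of a `ℤ_p`-extension form a system of representatives of `Γ_{n'}/Γ_m`

Cell `bsd-smallim`, seat `bsd-smallim-k6-g3` (gen 2).  THEOREMS ONLY (no definition, no named fact, no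
`sorry`); pure `ℤ_p`-extension arithmetic (any field `K`, any `κ : ZpExtension K p`), curve-free.
HONEST FRAMING: TOOL helper toward crux 19276 (conditional surface F2 via aside 19844
`KatoReductionModPKernel`); closes nothing.  PARTITION (D-0054): X9 (A4) × p ∈ {5,7}
(+ X10b∧¬Surj at 3) — helper; closes NONE.  Consumer: lur-a g2's
`UniversalNorms.mem_integralH1_of_layerCores_eq_of_smul_mem` (STATUS l.379), steps (d)/(b1): a
Frobenius `φ' ∈ D_𝔓 ∩ Γ_{n'}` of depth exactly `n'` gives the representatives `φ'^i` (`i < p^k`,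
`k = m − n'`) of `Γ_{n'}/Γ_m` — exactly the hypotheses `hcov`/`hinj` of this seat's
`UniversalNorms.sum_range_conjMap_pow_eq_resLe_coresLe` (p478890: `res ∘ cor = Σ_{i<p^k} (φ')^i ·`).

## What (`κ : ZpExtension K p`, `Γ_n = κ.layerSubgroup n`, `κ̄_m = κ.layerIndex m : Γ_K → ℤ/p^m`)

* `layerIndex_pow` — `κ̄_m(σ^i) = i • κ̄_m(σ)`.
* `layerIndex_eq_natCast_of_depth` — for `σ ∈ Γ_{n'} ∖ Γ_{n'+1}` and `n' + 1 ≤ m`: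
  `κ̄_m(σ) = p^{n'}·u` with `p ∤ u` (koly's `twistExponent_eq_prime_pow_mul_of_depth` + `natCast_twistExponent`).
* `layerIndex_eq_natCast_of_mem` — for `g ∈ Γ_{n'}`, `n' ≤ m`: `κ̄_m(g) = p^{n'}·c`.
* **`exists_pow_inv_mul_mem_layerSubgroup_of_depth`** (hcov) — for `σ` of depth `n'`, `n' ≤ m`, and
  `g ∈ Γ_{n'}`: `∃ i < p^{m−n'}, (σ^i)⁻¹ g ∈ Γ_m` (`i ≡ c·u⁻¹ (mod p^{m−n'})`).
* **`eq_of_pow_inv_mul_pow_mem_layerSubgroup_of_depth`** (hinj) — `(σ^{i₁})⁻¹ σ^{i₂} ∈ Γ_m` with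
  `i₁, i₂ < p^{m−n'}` forces `i₁ = i₂` (`p^{m−n'} ∣ (i₂ − i₁)·u`, `p ∤ u`).
* `exists_pow_inv_mul_mem_subgroupOf_of_depth`, `eq_of_pow_inv_mul_pow_mem_subgroupOf_of_depth` — the
  same for `σ, g : Γ_{n'}` with membership in `(Γ_m).subgroupOf Γ_{n'}` (the literal `hcov`/`hinj` of
  `sum_range_conjMap_pow_eq_resLe_coresLe` with `U = Γ_{n'}`, `N = Γ_m`).
* `mem_layerSubgroup_iff_le_valuation`, **`exists_depth_of_apply_ne_one`** (`κ φ ≠ 1 ⟹ φ` has an exact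
  depth `n₀`), **`pow_prime_pow_mem_layerSubgroup_and_not_mem`** (`φ^{p^j}` then has exact depth `n₀ + j`)
  — step (d): from ONE Frobenius `φ ∈ D_𝔓` with `κ φ ≠ 1`, Frobenii `φ^{p^{n'−n₀}} ∈ D_𝔓` of every
  depth `n' ≥ n₀` (above layer `n₀` the primes over `v` are inert).

References: L. Washington, *Introduction to Cyclotomic Fields* (1997) §13.1 (`Gal(K_m/K_{n'}) ≅ ℤ/p^{m−n'}`
cyclic, generated by any element of exact depth `n'`) [Washington1997]; K. Kato, Astérisque 295 (2004)
Lemma 8.5 (2) [Kato2004Asterisque].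
-/

-- the summit and its single problem are both named `BirchSwinnertonDyer` (registry layout D-0017)
set_option linter.dupNamespace false
set_option autoImplicit false

noncomputable section

open Field
open Literature.NumberTheory.EllipticCurves
open Literature.NumberTheory.EllipticCurves.ZpExtension
open Summit.BirchSwinnertonDyer.BirchSwinnertonDyer.Rank1Residual.LocalSplitPrime

universe u

namespace Summit.BirchSwinnertonDyer.BirchSwinnertonDyer.Rank1Residual.UniversalNorms

variable {K : Type u} [Field K] {p : ℕ} [Fact p.Prime] (κ : ZpExtension K p)

/-- `κ̄_m(σ^i) = i • κ̄_m(σ)` (`κ̄_m` is a homomorphism to `ℤ/p^m`). [cite: Washington1997, §13.1–§13.2] -/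
theorem layerIndex_pow (m : ℕ) (σ : absoluteGaloisGroup K) (i : ℕ) :
    κ.layerIndex m (σ ^ i) = i • κ.layerIndex m σ := by
  induction i with
  | zero => rw [pow_zero, layerIndex_one, zero_nsmul]
  | succ i ih => rw [pow_succ, layerIndex_mul, ih, succ_nsmul]

/-- **An element of depth exactly `n'` has `κ̄_m(σ) = p^{n'}·u` with `p ∤ u`** (`n' + 1 ≤ m`).
[cite: Washington1997, §13.1–§13.2] -/
theorem layerIndex_eq_natCast_of_depth {n' m : ℕ} (hm : n' + 1 ≤ m) {σ : absoluteGaloisGroup K}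
    (hσ : σ ∈ κ.layerSubgroup n') (hσ' : σ ∉ κ.layerSubgroup (n' + 1)) :
    ∃ u : ℕ, ¬ p ∣ u ∧ κ.layerIndex m σ = ((p ^ n' * u : ℕ) : ZMod (p ^ m)) := by
  obtain ⟨u, hu, hexp⟩ := twistExponent_eq_prime_pow_mul_of_depth κ hm hσ hσ'
  exact ⟨u, hu, by rw [← hexp, κ.natCast_twistExponent m m le_rfl σ]⟩

/-- For `g ∈ Γ_{n'}` and `n' ≤ m`: `κ̄_m(g) = p^{n'}·c` for some `c`. [cite: Washington1997, §13.1–§13.2] -/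
theorem layerIndex_eq_natCast_of_mem {n' m : ℕ} (hm : n' ≤ m) {g : absoluteGaloisGroup K}
    (hg : g ∈ κ.layerSubgroup n') :
    ∃ c : ℕ, κ.layerIndex m g = ((p ^ n' * c : ℕ) : ZMod (p ^ m)) := by
  obtain ⟨c, hc⟩ := κ.prime_pow_dvd_twistExponent hm hg
  exact ⟨c, by rw [← hc, κ.natCast_twistExponent m m le_rfl g]⟩

omit [Fact p.Prime] in
/-- `p^{n'} · (p^{m−n'} · t) = 0` in `ℤ/p^m` (`n' ≤ m`). [folklore] -/
private theorem cast_pow_mul_pow_mul_eq_zero {n' m : ℕ} (hm : n' ≤ m) (t : ZMod (p ^ m)) :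
    (p : ZMod (p ^ m)) ^ n' * ((p : ZMod (p ^ m)) ^ (m - n') * t) = 0 := by
  rw [← mul_assoc, ← pow_add, Nat.add_sub_cancel' hm]
  have h : ((p : ZMod (p ^ m)) ^ m) = 0 := by exact_mod_cast ZMod.natCast_self (p ^ m)
  rw [h, zero_mul]

/-- **(hcov) The powers of a depth-`n'` element reach every coset of `Γ_{n'}/Γ_m`.**  For `σ ∈ Γ_{n'} ∖
Γ_{n'+1}`, `n' ≤ m` and `g ∈ Γ_{n'}` there is `i < p^{m−n'}` with `(σ^i)⁻¹ g ∈ Γ_m`: writing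
`κ̄_m(σ) = p^{n'}u` (`p ∤ u`) and `κ̄_m(g) = p^{n'}c`, take `i ≡ c·u⁻¹ (mod p^{m−n'})`.
[cite: Washington1997, §13.1–§13.2] -/
theorem exists_pow_inv_mul_mem_layerSubgroup_of_depth {n' m : ℕ} (hm : n' ≤ m)
    {σ : absoluteGaloisGroup K} (hσ : σ ∈ κ.layerSubgroup n') (hσ' : σ ∉ κ.layerSubgroup (n' + 1))
    {g : absoluteGaloisGroup K} (hg : g ∈ κ.layerSubgroup n') :
    ∃ i < p ^ (m - n'), (σ ^ i)⁻¹ * g ∈ κ.layerSubgroup m := by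
  have hp : p.Prime := Fact.out
  rcases Nat.eq_or_lt_of_le hm with rfl | hlt
  · -- `m = n'`: the trivial quotient
    refine ⟨0, by rw [Nat.sub_self, pow_zero]; exact Nat.one_pos, ?_⟩
    rwa [pow_zero, inv_one, one_mul]
  obtain ⟨u, hu, hσu⟩ := layerIndex_eq_natCast_of_depth κ (m := m) hlt hσ hσ'
  obtain ⟨c, hgc⟩ := layerIndex_eq_natCast_of_mem κ hm hg
  -- `i ≡ c · u⁻¹ (mod p^k)`
  have hcop : Nat.Coprime u (p ^ (m - n')) :=
    (Nat.Coprime.pow_right _ ((Nat.Prime.coprime_iff_not_dvd hp).mpr hu).symm)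
  obtain ⟨i, hi, hiu⟩ := Nat.exists_mul_mod_eq_of_coprime c hcop (pow_ne_zero _ hp.ne_zero)
  refine ⟨i, hi, ?_⟩
  -- `κ̄_m((σ^i)⁻¹ g) = p^{n'}(c − i u) = 0`
  rw [← layerIndex_eq_zero_iff, layerIndex_mul, layerIndex_inv, layerIndex_pow, hσu, hgc, nsmul_eq_mul]
  have hdvd : ((p ^ (m - n') : ℕ) : ℤ) ∣ (c : ℤ) - (u * i : ℕ) := Nat.modEq_iff_dvd.mp hiu
  obtain ⟨t, ht⟩ := hdvd
  have key : (-((i : ZMod (p ^ m)) * ((p ^ n' * u : ℕ) : ZMod (p ^ m))) + ((p ^ n' * c : ℕ) : ZMod (p ^ m)))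
      = (((p : ℤ) ^ n' * ((c : ℤ) - (u * i : ℕ)) : ℤ) : ZMod (p ^ m)) := by
    push_cast; ring
  rw [key, ht]
  push_cast
  exact cast_pow_mul_pow_mul_eq_zero (p := p) hm _

/-- **(hinj) Distinct small powers of a depth-`n'` element lie in distinct cosets of `Γ_m`.**  For
`σ ∈ Γ_{n'} ∖ Γ_{n'+1}`, `n' ≤ m`, and `i₁, i₂ < p^{m−n'}`: `(σ^{i₁})⁻¹ σ^{i₂} ∈ Γ_m ⟹ i₁ = i₂`
(`p^m ∣ (i₂ − i₁)·p^{n'}u` with `p ∤ u` forces `p^{m−n'} ∣ i₂ − i₁`). [cite: Washington1997, §13.1–§13.2] -/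
theorem eq_of_pow_inv_mul_pow_mem_layerSubgroup_of_depth {n' m : ℕ} (hm : n' ≤ m)
    {σ : absoluteGaloisGroup K} (hσ : σ ∈ κ.layerSubgroup n') (hσ' : σ ∉ κ.layerSubgroup (n' + 1))
    {i₁ i₂ : ℕ} (h₁ : i₁ < p ^ (m - n')) (h₂ : i₂ < p ^ (m - n'))
    (h : (σ ^ i₁)⁻¹ * σ ^ i₂ ∈ κ.layerSubgroup m) : i₁ = i₂ := by
  have hp : p.Prime := Fact.out
  rcases Nat.eq_or_lt_of_le hm with rfl | hlt
  · rw [Nat.sub_self, pow_zero] at h₁ h₂; omega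
  obtain ⟨u, hu, hσu⟩ := layerIndex_eq_natCast_of_depth κ (m := m) hlt hσ hσ'
  rw [← layerIndex_eq_zero_iff, layerIndex_mul, layerIndex_inv, layerIndex_pow, layerIndex_pow, hσu,
    nsmul_eq_mul, nsmul_eq_mul] at h
  -- `p^m ∣ (i₂ − i₁) · p^{n'} · u` in `ℤ`
  have hcast : ((((i₂ : ℤ) - i₁) * u * (p : ℤ) ^ n' : ℤ) : ZMod (p ^ m)) = 0 := by
    rw [← h]; push_cast; ring
  rw [ZMod.intCast_zmod_eq_zero_iff_dvd] at hcast
  have hsplit : ((p ^ m : ℕ) : ℤ) = (p : ℤ) ^ (m - n') * (p : ℤ) ^ n' := by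
    rw [← pow_add, Nat.sub_add_cancel hm]; push_cast; rfl
  rw [hsplit] at hcast
  have hpn : (p : ℤ) ^ n' ≠ 0 := pow_ne_zero _ (Int.natCast_ne_zero.mpr hp.ne_zero)
  have hdvd : (p : ℤ) ^ (m - n') ∣ ((i₂ : ℤ) - i₁) * u := (mul_dvd_mul_iff_right hpn).mp hcast
  -- `p^{m−n'}` is prime to `u`
  have hcop : IsCoprime ((p : ℤ) ^ (m - n')) (u : ℤ) := by
    have h' : Nat.Coprime (p ^ (m - n')) u :=
      Nat.Coprime.pow_left _ ((Nat.Prime.coprime_iff_not_dvd hp).mpr hu)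
    have := Nat.isCoprime_iff_coprime.mpr h'
    simpa using this
  have hdvd' : (p : ℤ) ^ (m - n') ∣ (i₂ : ℤ) - i₁ := hcop.dvd_of_dvd_mul_right hdvd
  have h₁' : (i₁ : ℤ) < (p : ℤ) ^ (m - n') := by exact_mod_cast h₁
  have h₂' : (i₂ : ℤ) < (p : ℤ) ^ (m - n') := by exact_mod_cast h₂
  have habs : |(i₂ : ℤ) - i₁| < (p : ℤ) ^ (m - n') := by
    rw [abs_sub_lt_iff]; constructor <;> omega
  have h0 := Int.eq_zero_of_abs_lt_dvd hdvd' habs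
  omega

/-- **(hcov) in `subgroupOf` form**, for `σ, g : Γ_{n'}` (the literal hypothesis of
`sum_range_conjMap_pow_eq_resLe_coresLe` with `U = Γ_{n'}`, `N = Γ_m`). [cite: Washington1997, §13.1–§13.2] -/
theorem exists_pow_inv_mul_mem_subgroupOf_of_depth {n' m : ℕ} (hm : n' ≤ m)
    {σ : κ.layerSubgroup n'} (hσ' : (σ : absoluteGaloisGroup K) ∉ κ.layerSubgroup (n' + 1))
    (g : κ.layerSubgroup n') :
    ∃ i < p ^ (m - n'), (σ ^ i)⁻¹ * g ∈ (κ.layerSubgroup m).subgroupOf (κ.layerSubgroup n') := by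
  obtain ⟨i, hi, hmem⟩ := exists_pow_inv_mul_mem_layerSubgroup_of_depth κ hm σ.2 hσ' g.2
  refine ⟨i, hi, ?_⟩
  rw [Subgroup.mem_subgroupOf, Subgroup.coe_mul, Subgroup.coe_inv, Subgroup.coe_pow]
  exact hmem

/-- **(hinj) in `subgroupOf` form**, for `σ : Γ_{n'}`. [cite: Washington1997, §13.1–§13.2] -/
theorem eq_of_pow_inv_mul_pow_mem_subgroupOf_of_depth {n' m : ℕ} (hm : n' ≤ m)
    {σ : κ.layerSubgroup n'} (hσ' : (σ : absoluteGaloisGroup K) ∉ κ.layerSubgroup (n' + 1))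
    {i₁ i₂ : ℕ} (h₁ : i₁ < p ^ (m - n')) (h₂ : i₂ < p ^ (m - n'))
    (h : (σ ^ i₁)⁻¹ * σ ^ i₂ ∈ (κ.layerSubgroup m).subgroupOf (κ.layerSubgroup n')) : i₁ = i₂ := by
  rw [Subgroup.mem_subgroupOf, Subgroup.coe_mul, Subgroup.coe_inv, Subgroup.coe_pow,
    Subgroup.coe_pow] at h
  exact eq_of_pow_inv_mul_pow_mem_layerSubgroup_of_depth κ hm σ.2 hσ' h₁ h₂ h

/-! ### Exact depth: existence for `κ φ ≠ 1`, and depth of `p`-power powers -/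

/-- **Membership in a layer through the `p`-adic valuation**: for `κ φ ≠ 1` (i.e. `x := κ φ ≠ 0` in
`ℤ_p`), `φ ∈ Γ_n ↔ n ≤ v_p(x)`. [cite: Washington1997, §13.1–§13.2] -/
theorem mem_layerSubgroup_iff_le_valuation {φ : absoluteGaloisGroup K} (hφ : (κ φ).toAdd ≠ 0) (n : ℕ) :
    φ ∈ κ.layerSubgroup n ↔ n ≤ ((κ φ).toAdd).valuation := by
  rw [mem_layerSubgroup, ← Ideal.mem_span_singleton, PadicInt.mem_span_pow_iff_le_valuation _ hφ]

/-- **Every element on which `κ` is non-trivial has an exact depth**: `κ φ ≠ 1 ⟹ ∃ n₀, φ ∈ Γ_{n₀} ∖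
Γ_{n₀+1}` (`n₀ = v_p(κ φ)`).  For the cyclotomic `κ` and a Frobenius `φ` at a place `v ≠ p` this is
"`v` is finitely decomposed in `K_∞`". [cite: Washington1997, §13.1–§13.2] -/
theorem exists_depth_of_apply_ne_one {φ : absoluteGaloisGroup K} (hφ : κ φ ≠ 1) :
    ∃ n₀ : ℕ, φ ∈ κ.layerSubgroup n₀ ∧ φ ∉ κ.layerSubgroup (n₀ + 1) := by
  have hx : (κ φ).toAdd ≠ 0 := fun h => hφ (by rw [← ofAdd_toAdd (κ φ), h, ofAdd_zero])
  refine ⟨((κ φ).toAdd).valuation, ?_, ?_⟩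
  · rw [mem_layerSubgroup_iff_le_valuation κ hx]
  · rw [mem_layerSubgroup_iff_le_valuation κ hx]; omega

/-- **`p`-power powers raise the depth**: if `φ ∈ Γ_{n₀} ∖ Γ_{n₀+1}` then `φ^{p^j} ∈ Γ_{n₀+j} ∖
Γ_{n₀+j+1}` (`κ(φ^{p^j}) = p^j · κ(φ)` has valuation `j + v_p(κ φ)`).  So from ONE Frobenius `φ ∈ D_𝔓`
with `κ φ ≠ 1` one gets, for every `n' ≥ n₀`, a Frobenius `φ^{p^{n'−n₀}} ∈ D_𝔓` of depth exactly `n'`.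
[cite: Washington1997, §13.1–§13.2] -/
theorem pow_prime_pow_mem_layerSubgroup_and_not_mem {φ : absoluteGaloisGroup K} {n₀ : ℕ}
    (hφ : φ ∈ κ.layerSubgroup n₀) (hφ' : φ ∉ κ.layerSubgroup (n₀ + 1)) (j : ℕ) :
    φ ^ p ^ j ∈ κ.layerSubgroup (n₀ + j) ∧ φ ^ p ^ j ∉ κ.layerSubgroup (n₀ + j + 1) := by
  have hx : (κ φ).toAdd ≠ 0 := by
    intro h
    apply hφ'
    rw [mem_layerSubgroup, h]
    exact dvd_zero _
  have hval : n₀ = ((κ φ).toAdd).valuation := by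
    have h1 := (mem_layerSubgroup_iff_le_valuation κ hx n₀).mp hφ
    have h2 : ¬ n₀ + 1 ≤ ((κ φ).toAdd).valuation :=
      fun h => hφ' ((mem_layerSubgroup_iff_le_valuation κ hx (n₀ + 1)).mpr h)
    omega
  have hpow : (κ (φ ^ p ^ j)).toAdd = (p : ℤ_[p]) ^ j * (κ φ).toAdd := by
    rw [map_pow, toAdd_pow, nsmul_eq_mul, Nat.cast_pow]
  have hx' : (κ (φ ^ p ^ j)).toAdd ≠ 0 := by
    rw [hpow]; exact mul_ne_zero (pow_ne_zero _ (NeZero.ne _)) hx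
  have hval' : ((κ (φ ^ p ^ j)).toAdd).valuation = j + n₀ := by
    rw [hpow, PadicInt.valuation_p_pow_mul j _ hx, ← hval]
  refine ⟨(mem_layerSubgroup_iff_le_valuation κ hx' _).mpr (by rw [hval']; omega), fun h => ?_⟩
  have := (mem_layerSubgroup_iff_le_valuation κ hx' _).mp h
  rw [hval'] at this
  omega

end Summit.BirchSwinnertonDyer.BirchSwinnertonDyer.Rank1Residual.UniversalNorms

end
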